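import Mathlib
import Summits.Ventures.HodgeRepro0.P1LatticeIndexTwoExactCore3

/-!
# P1LatticeObstructionSourceCore — THE OBSTRUCTION SOURCE IN THE KERNEL, THE CORE: the general lemmas by which a landed
index-2 certificate `index_two_M : H_M ⊓ L_M = H_M ⊓ {χ_M even}` (the g28 / study-10 artefacts, lean/P1LatticeIndexTwoExactA … N.lean
and lean/P1LatticeIndexTwoExact180A1 … AB13.lean) and ONE vector w ∈ H_M of ODD parity give H_M = (H_M ⊓ L_M) ⊔ ℤ·w and
H_M ≤ L_M ⊔ ℤ·w — «the class of w generates H_M/L_M» —, and the two-functional forms for a landed index-4 certificate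
`index_four_165 : H ⊓ L = H ⊓ ({χ even} ⊓ {χ_b even})` (the study-11 artefact lean/P1LatticeIndexTwoExact180AC1 … AC16.lean)
(pub-hodge-repro0, p1 (g32), 2026-08-30; STUDY 12, STATUS ANNOUNCEMENT 1).  Used by the per-degree files
lean/P1LatticeObstructionSource<M>.lean at the twenty-three pulled-back degrees of the D13 object's §3′ (b)
(proofs/P1-FermatLatticeClosure-v1.3.md l.19) and the (fl) page's §3′ (a) (proofs/P1-FermatLatticeClosure180-v1.2.md l.71),
where w = s((M/q)·x_q) is the odd vector of the pull-back of the divisor's D13 witness.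

Supporting artefact in the sense of ROUTE.md R-5 (finite combinatorics / exact arithmetic only; never the discharge of a
Hodge-theoretic step; record-only).  Nothing of record is touched; the core files Core1–3 are imported as they stand and
nothing is re-declared.  NOT formalised: L_M ⊆ H_M (every block is a Hodge multiset — the page's Lemma 1 (b)/(d)); claim(·) for
the blocks; anything Hodge-theoretic.
Nothing here asserts anything about whether the statement of README §1 has been proved elsewhere.
-/

namespace HodgeRepro0.P1.P1LatticeObstructionSource
open HodgeRepro0.P1.P1LatticeIndexTwoExact

/-- membership in the even-parity sublattice `comap φ_χ (span {2})` is even parity of φ_χ -/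
theorem mem_even_iff {n : ℕ} (chi : Fin n → ℤ) (s : Fin n → ℤ) :
    s ∈ Submodule.comap (phi chi) (Ideal.span {(2 : ℤ)}) ↔ phi chi s % 2 = 0 := by
  rw [Submodule.mem_comap, Ideal.mem_span_singleton]
  constructor
  · rintro ⟨k, hk⟩
    omega
  · intro h
    exact Int.dvd_of_emod_eq_zero h

/-- THE GENERATION LEMMA (one functional): if H ⊓ L is exactly the even-parity part of H (a landed `index_two_M`) and w ∈ H has
odd parity, then H = (H ⊓ L) ⊔ ℤ·w — the class of w generates H/(H ⊓ L) ≅ ℤ/2 -/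
theorem sup_of_index_two {n : ℕ} (H L : Submodule ℤ (Fin n → ℤ)) (chi : Fin n → ℤ)
    (hHL : H ⊓ L = H ⊓ Submodule.comap (phi chi) (Ideal.span {(2 : ℤ)}))
    (w : Fin n → ℤ) (hw : w ∈ H) (hpar : phi chi w % 2 = 1) :
    H = (H ⊓ L) ⊔ Submodule.span ℤ {w} := by
  apply le_antisymm
  · intro s hs
    by_cases he : phi chi s % 2 = 0
    · have h1 : s ∈ H ⊓ L := by
        rw [hHL]
        exact ⟨hs, (mem_even_iff chi s).mpr he⟩
      exact Submodule.mem_sup_left h1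
    · have h1 : s - w ∈ H ⊓ L := by
        rw [hHL]
        refine ⟨H.sub_mem hs hw, (mem_even_iff chi _).mpr ?_⟩
        rw [map_sub]
        omega
      have h2 : w ∈ Submodule.span ℤ {w} := Submodule.mem_span_singleton_self w
      have h3 := Submodule.add_mem_sup h1 h2
      rwa [sub_add_cancel] at h3
  · exact sup_le inf_le_left ((Submodule.span_singleton_le_iff_mem w H).mpr hw)

/-- the same, stated against L: H ≤ L ⊔ ℤ·w — with L ⊆ H (not formalised) this is the page's «L + ℤ·s(w) = H» -/
theorem le_sup_of_index_two {n : ℕ} (H L : Submodule ℤ (Fin n → ℤ)) (chi : Fin n → ℤ)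
    (hHL : H ⊓ L = H ⊓ Submodule.comap (phi chi) (Ideal.span {(2 : ℤ)}))
    (w : Fin n → ℤ) (hw : w ∈ H) (hpar : phi chi w % 2 = 1) :
    H ≤ L ⊔ Submodule.span ℤ {w} := by
  rw [sup_of_index_two H L chi hHL w hw hpar]
  exact sup_le_sup_right inf_le_right _

/-- THE GENERATION LEMMA (two functionals): if H ⊓ L is exactly the part of H even for both χ and χ_b (a landed `index_four_M`)
and w₁, w₂ ∈ H have the parity patterns (odd, even) and (even, odd), then H = (H ⊓ L) ⊔ ℤ·{w₁, w₂} — the two classes generate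
H/(H ⊓ L) ≅ (ℤ/2)² -/
theorem sup_of_index_four {n : ℕ} (H L : Submodule ℤ (Fin n → ℤ)) (chi chib : Fin n → ℤ)
    (hHL : H ⊓ L = H ⊓ (Submodule.comap (phi chi) (Ideal.span {(2 : ℤ)}) ⊓
      Submodule.comap (phi chib) (Ideal.span {(2 : ℤ)})))
    (w₁ w₂ : Fin n → ℤ) (hw₁ : w₁ ∈ H) (hw₂ : w₂ ∈ H)
    (h11 : phi chi w₁ % 2 = 1) (h12 : phi chib w₁ % 2 = 0)
    (h21 : phi chi w₂ % 2 = 0) (h22 : phi chib w₂ % 2 = 1) :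
    H = (H ⊓ L) ⊔ Submodule.span ℤ {w₁, w₂} := by
  have m1 : w₁ ∈ Submodule.span ℤ {w₁, w₂} := Submodule.subset_span (by simp)
  have m2 : w₂ ∈ Submodule.span ℤ {w₁, w₂} := Submodule.subset_span (by simp)
  apply le_antisymm
  · intro s hs
    -- the residue t of s modulo the two witnesses lies in H ⊓ L; s = t + (the witnesses used)
    have key : ∀ t : Fin n → ℤ, t ∈ H → phi chi t % 2 = 0 → phi chib t % 2 = 0 → t ∈ H ⊓ L := by
      intro t ht h1 h2
      rw [hHL]
      exact ⟨ht, (mem_even_iff chi t).mpr h1, (mem_even_iff chib t).mpr h2⟩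
    rcases Int.emod_two_eq_zero_or_one (phi chi s) with ha | ha <;>
      rcases Int.emod_two_eq_zero_or_one (phi chib s) with hb | hb
    · exact Submodule.mem_sup_left (key s hs ha hb)
    · have h1 := key (s - w₂) (H.sub_mem hs hw₂) (by rw [map_sub]; omega) (by rw [map_sub]; omega)
      have h3 := Submodule.add_mem_sup h1 m2
      rwa [sub_add_cancel] at h3
    · have h1 := key (s - w₁) (H.sub_mem hs hw₁) (by rw [map_sub]; omega) (by rw [map_sub]; omega)
      have h3 := Submodule.add_mem_sup h1 m1
      rwa [sub_add_cancel] at h3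
    · have h1 := key (s - w₁ - w₂) (H.sub_mem (H.sub_mem hs hw₁) hw₂)
        (by rw [map_sub, map_sub]; omega) (by rw [map_sub, map_sub]; omega)
      have h3 := Submodule.add_mem_sup h1 (Submodule.add_mem _ m1 m2)
      rwa [sub_sub, sub_add_cancel] at h3
  · refine sup_le inf_le_left ?_
    rw [Submodule.span_le]
    rintro x hx
    simp only [Set.mem_insert_iff, Set.mem_singleton_iff] at hx
    rcases hx with rfl | rfl
    · exact hw₁
    · exact hw₂

/-- the same, stated against L: H ≤ L ⊔ ℤ·{w₁, w₂} -/
theorem le_sup_of_index_four {n : ℕ} (H L : Submodule ℤ (Fin n → ℤ)) (chi chib : Fin n → ℤ)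
    (hHL : H ⊓ L = H ⊓ (Submodule.comap (phi chi) (Ideal.span {(2 : ℤ)}) ⊓
      Submodule.comap (phi chib) (Ideal.span {(2 : ℤ)})))
    (w₁ w₂ : Fin n → ℤ) (hw₁ : w₁ ∈ H) (hw₂ : w₂ ∈ H)
    (h11 : phi chi w₁ % 2 = 1) (h12 : phi chib w₁ % 2 = 0)
    (h21 : phi chi w₂ % 2 = 0) (h22 : phi chib w₂ % 2 = 1) :
    H ≤ L ⊔ Submodule.span ℤ {w₁, w₂} := by
  rw [sup_of_index_four H L chi chib hHL w₁ w₂ hw₁ hw₂ h11 h12 h21 h22]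
  exact sup_le_sup_right inf_le_right _

/-- THE HALVING LEMMA: with a landed `index_four` and w₁ ∈ H of pattern (odd, even), adjoining w₁ alone to L cuts H down to
exactly the χ_b-even part: H ⊓ (L ⊔ ℤ·w₁) = H ⊓ {χ_b even} — the index 4 halves to 2 -/
theorem meet_of_index_four {n : ℕ} (H L : Submodule ℤ (Fin n → ℤ)) (chi chib : Fin n → ℤ)
    (hHL : H ⊓ L = H ⊓ (Submodule.comap (phi chi) (Ideal.span {(2 : ℤ)}) ⊓
      Submodule.comap (phi chib) (Ideal.span {(2 : ℤ)})))
    (w₁ : Fin n → ℤ) (hw₁ : w₁ ∈ H) (h11 : phi chi w₁ % 2 = 1) (h12 : phi chib w₁ % 2 = 0) :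
    H ⊓ (L ⊔ Submodule.span ℤ {w₁}) = H ⊓ Submodule.comap (phi chib) (Ideal.span {(2 : ℤ)}) := by
  apply le_antisymm
  · intro s hs'
    obtain ⟨hs, hsup⟩ := Submodule.mem_inf.mp hs'
    refine Submodule.mem_inf.mpr ⟨hs, (mem_even_iff chib s).mpr ?_⟩
    have hsup' : s ∈ L ⊔ Submodule.span ℤ {w₁} := hsup
    obtain ⟨l, hl, y, hy, rfl⟩ := Submodule.mem_sup.mp hsup'
    obtain ⟨c, rfl⟩ := Submodule.mem_span_singleton.mp hy
    have hlH : l ∈ H := by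
      have : l = (l + c • w₁) - c • w₁ := by abel
      rw [this]
      exact H.sub_mem hs (H.smul_mem c hw₁)
    have hlHL : l ∈ H ⊓ L := ⟨hlH, hl⟩
    rw [hHL] at hlHL
    have hle : phi chib l % 2 = 0 := (mem_even_iff chib l).mp hlHL.2.2
    have hc : (c * phi chib w₁) % 2 = 0 := by
      rw [Int.mul_emod, h12]
      simp
    rw [map_add, map_smul, smul_eq_mul]
    omega
  · intro s hs'
    obtain ⟨hs, hb⟩ := Submodule.mem_inf.mp hs'
    refine Submodule.mem_inf.mpr ⟨hs, ?_⟩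
    have hb' : phi chib s % 2 = 0 := (mem_even_iff chib s).mp hb
    rcases Int.emod_two_eq_zero_or_one (phi chi s) with ha | ha
    · have h1 : s ∈ H ⊓ L := by
        rw [hHL]
        exact ⟨hs, (mem_even_iff chi s).mpr ha, hb⟩
      exact Submodule.mem_sup_left h1.2
    · have h1 : s - w₁ ∈ H ⊓ L := by
        rw [hHL]
        exact ⟨H.sub_mem hs hw₁, (mem_even_iff chi _).mpr (by rw [map_sub]; omega),
          (mem_even_iff chib _).mpr (by rw [map_sub]; omega)⟩
      have h3 := Submodule.add_mem_sup h1.2 (Submodule.mem_span_singleton_self w₁)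
      rwa [sub_add_cancel] at h3

/-- the halving lemma with the roles of the two functionals exchanged: w₂ ∈ H of pattern (even, odd) gives
H ⊓ (L ⊔ ℤ·w₂) = H ⊓ {χ even} -/
theorem meet_of_index_four' {n : ℕ} (H L : Submodule ℤ (Fin n → ℤ)) (chi chib : Fin n → ℤ)
    (hHL : H ⊓ L = H ⊓ (Submodule.comap (phi chi) (Ideal.span {(2 : ℤ)}) ⊓
      Submodule.comap (phi chib) (Ideal.span {(2 : ℤ)})))
    (w₂ : Fin n → ℤ) (hw₂ : w₂ ∈ H) (h21 : phi chi w₂ % 2 = 0) (h22 : phi chib w₂ % 2 = 1) :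
    H ⊓ (L ⊔ Submodule.span ℤ {w₂}) = H ⊓ Submodule.comap (phi chi) (Ideal.span {(2 : ℤ)}) := by
  apply meet_of_index_four H L chib chi _ w₂ hw₂ h22 h21
  rw [hHL, inf_comm (Submodule.comap (phi chi) _)]

end HodgeRepro0.P1.P1LatticeObstructionSource
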